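import Summits.QuantumFields.YangMills.Theorems.FluctuationComparisonRegPrIntLOrganTangentFibreMeanTools
import Literature.MathematicalPhysics.QuantumFieldTheory.Balaban1983to89.Node00.RegSetOfFibredChart
import Literature.MathematicalPhysics.QuantumFieldTheory.Balaban1983to89.T3UnitScaleTilt
import Literature.MathematicalPhysics.QuantumFieldTheory.Balaban1983to89.T3OrbitAverage
import HarnessLib

/-!
# Crux `FluctuationComparisonRegPrIntL` (stmt-QuantumFields-20520, rung R3), PATH-B organ-tangent lane — THE FIBRED-CHART BRIDGE, INTEGRAND EDITION,
# GENERIC CUT: ✓`…OrganTangentFibredChartBridgeIntegrand` (p782334, LEAD w3 g22) with `3 ∕ 4 ↦ cW`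

LEAD-20520 width seat ym-ust-20520-w3 g23 (cell ym3-torus), `--supports stmt-QuantumFields-20520` (helper).  THEOREMS ONLY, def-free; statement and
proof of ★`regularPackage_of_fibredChart_of_integrand` are the landed ones BYTE FOR BYTE except that the window constant `3 ∕ 4` is the free
binder `(cW : ℝ)` (no hypothesis on `cW` is needed here: the `cW`-window only enters as an open measurable set and as the support condition of the
test functions).

WHY A GENERIC-CUT EDITION (R-CUT-χ, LEAD WORD №1 (iii) ∕ ideator ym-r3-idea-1 g26 №3 «GO v2.6 ∕ v17.2», 2026-08-30).  Row VER∘ needs every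
coarse-window fibre of `descend` to meet `{χ > 0} = {PlaqSmall (c₂·θ_{j+1})}`, `c₂θ` the TOP of the cutoff ramp — i.e. exact one-step small lifts with
gain `κ√L ≤ c₂` from a height.  The tree's certified kernels give `κ√L ≤ 0.9482…` at `L = 3` (`CertL3Tree.certL3_clause`), `0.860 ∕ 0.805` at
`L = 5 ∕ 7` (ANSATZ S), `≤ 2∕3` for odd `L ≥ 9` (ANSATZ T): the v2–v2.5 top `cW` is served for `L ≥ 9` only (✓`…SpreadLiftOfSmallLift`), any top in
`(0.9483, 1)` for EVERY odd `L ≥ 3`.  The line therefore re-cut `sfCut` to the ramp `(c₁, c₂) = (1∕2, 24∕25)` (token of record: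
`∏ p, max 0 (min 1 ((24 ∕ 25 * θ − dist1 (plaqHol U p)) ∕ ((24 ∕ 25 − 1 ∕ 2) * θ)))`), and the (A)-currency files are re-issued with the window
constant a FREE real `cW` in place of the literal `3 ∕ 4` (consumers instantiate `cW := 24 ∕ 25`; `cW := 3 ∕ 4` recovers the landed edition).

CONTENT: a T⁴-style fibred chart `(Z, τ, Φ, J, S)` of `descend F ℰp j` over the coarse window on `S ⊇ {PlaqSmall (cW·θ_{j+1})}` (`havgΦ`, `hmap`
— the binders of `Node00.RegSetOfFibredChart.integral_mul_comp_eq_integral_fibreIntegral_mul` at `ν := dU_{j+1}`, `μ := dU_j`), (C1′) integrand-level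
a.e. continuity `hint`, (C2) a `τ`-integrable bound `hJB`, (C3) the chart mass `hmass` of the `cW`-window ⟹ `∃ λ` finite with (A1)(A2)(A3) in the
binder shapes of the generic-cut knit ✓`…OrganTangentFibreMeanVersionKnitAnyCut`. [cite: Balaban1987RG1, (2.10) p.267 and (0.13) p.254; Balaban1985Averaging, (10) p.19]

HONEST FRAMING: a mechanical generalisation (`3 ∕ 4 ↦ cW`) of a landed, kernel-checked helper over hypothesis letters; nothing of Bałaban's
analysis is asserted or proved; (A), VER∘ (as a row), LIN∘, JEN∘, O1, crux 20520 `FluctuationComparisonRegPrIntL`, `YM3TorusSU2` are NOT proved; the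
registry `Lines/semiclassical_s2beta.lean` v11.4 (★★OWNER RULING №36) is untouched and nothing here is registered; rung R3 = SU(2) YM₃ on T³ —
NOT d = 4, NOT infinite volume, NOT a mass gap, NOT Clay; the Yang–Mills mass gap is NOT proved by any of this.
-/

set_option autoImplicit false

noncomputable section

namespace Summit.QuantumFields.YangMills.Theorems.OrganTangentFibredChartBridgeIntegrandAnyCut

open MeasureTheory ProbabilityTheory Filter Topology Set
open scoped ENNReal NNReal
open Literature.MathematicalPhysics.QuantumFieldTheory.Balaban1983to89
open T3ContinuumYM3Torus T3NestedUnitLaws T3UnitLawDensityEML T3UnitScaleTilt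
open Literature.MathematicalPhysics.QuantumFieldTheory.Balaban1983to89.T3OrbitAverage
open Summit.QuantumFields.YangMills.Theorems.OrganTangentFibreMeanTools

/-- ★ **FIBRED CHART OF `descend` OVER THE COARSE WINDOW, INTEGRAND-LEVEL CONTINUITY ⟹ THE (A)-PACKAGE** (for any ONE disintegration `σ₀`); as
✓`OrganTangentFibredChartBridge.regularPackage_of_fibredChart` with (C1) `hΦc`∕`hJc` replaced by (C1′) `hint`.  Data: the T⁴-style chart
`(Z, τ, Φ, J, S)` of `descend F ℰp j` over `U = {PlaqSmall θ_j}` on `S ⊇ {PlaqSmall cW·θ_{j+1}}` (`havgΦ`, `hmap` — the binders of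
`Node00.RegSetOfFibredChart.integral_mul_comp_eq_integral_fibreIntegral_mul` VERBATIM at `ν := dU_{j+1}`, `μ := dU_j`, `avg := descend F ℰp j`); regularity (C1)
`hΦc`∕`hJc`, bound (C2) `hJB`, mass (C3) `hmass`.  Conclusion: `∃ λ`, finite, with (A1) (A2) (A3) in the binder shapes of
★`OrganTangentFibreMeanVersionKnit.fibreMeanVersion_of_regularSmallFieldDisintegration` (v3). [cite: Balaban1987RG1, (2.10) p.267 and (0.13) p.254; Balaban1985Averaging, (10) p.19] -/
theorem regularPackage_of_fibredChart_of_integrand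
    (F : T3Family) (γ b₀ p₀ : ℝ) (j : ℕ) (cW : ℝ)
    (σ₀ : Kernel (GaugeField (F.P j) 0 ↥(Matrix.specialUnitaryGroup (Fin 2) ℂ))
      (GaugeField (F.P (j + 1)) 0 ↥(Matrix.specialUnitaryGroup (Fin 2) ℂ)))
    (hσ₀M : IsMarkovKernel σ₀)
    (hbind₀ : (Measure.map (descend F ℰp j) (fieldMeasure (F.P (j + 1)) 0 ↥(Matrix.specialUnitaryGroup (Fin 2) ℂ))).bind ⇑σ₀ =
      fieldMeasure (F.P (j + 1)) 0 ↥(Matrix.specialUnitaryGroup (Fin 2) ℂ))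
    (hfib₀ : ∀ᵐ V ∂(Measure.map (descend F ℰp j) (fieldMeasure (F.P (j + 1)) 0 ↥(Matrix.specialUnitaryGroup (Fin 2) ℂ))),
      ∀ᵐ U ∂(σ₀ V), descend F ℰp j U = V)
    {Z : Type*} [MeasurableSpace Z] (τ : Measure Z) [SFinite τ]
    (Φ : GaugeField (F.P j) 0 ↥(Matrix.specialUnitaryGroup (Fin 2) ℂ) × Z → GaugeField (F.P (j + 1)) 0 ↥(Matrix.specialUnitaryGroup (Fin 2) ℂ))
    (hΦ : Measurable Φ)
    (J : GaugeField (F.P j) 0 ↥(Matrix.specialUnitaryGroup (Fin 2) ℂ) × Z → ℝ≥0) (hJ : Measurable J)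
    (S : Set (GaugeField (F.P (j + 1)) 0 ↥(Matrix.specialUnitaryGroup (Fin 2) ℂ)))
    (hS : ∀ U, PlaqSmall (cW * θBal F.L γ b₀ p₀ (j + 1)) U → U ∈ S)
    (havgΦ : ∀ V ∈ {V | PlaqSmall (θBal F.L γ b₀ p₀ j) V}, ∀ z, descend F ℰp j (Φ (V, z)) = V)
    (hmap : (fieldMeasure (F.P (j + 1)) 0 ↥(Matrix.specialUnitaryGroup (Fin 2) ℂ)).restrict
        (descend F ℰp j ⁻¹' {V | PlaqSmall (θBal F.L γ b₀ p₀ j) V} ∩ S) =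
      ((((fieldMeasure (F.P j) 0 ↥(Matrix.specialUnitaryGroup (Fin 2) ℂ)).restrict {V | PlaqSmall (θBal F.L γ b₀ p₀ j) V}).prod τ).withDensity
        (fun p => (J p : ℝ≥0∞))).map Φ)
    (hint : ∀ f : GaugeField (F.P (j + 1)) 0 ↥(Matrix.specialUnitaryGroup (Fin 2) ℂ) → ℝ, Continuous f →
      (∀ U, f U ≠ 0 → PlaqSmall (cW * θBal F.L γ b₀ p₀ (j + 1)) U) →
      ∀ᵐ z ∂τ, ContinuousOn (fun V => (J (V, z) : ℝ) * f (Φ (V, z))) {V | PlaqSmall (θBal F.L γ b₀ p₀ j) V})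
    (B : Z → ℝ) (hB : Integrable B τ)
    (hJB : ∀ V, PlaqSmall (θBal F.L γ b₀ p₀ j) V → ∀ᵐ z ∂τ, (J (V, z) : ℝ) ≤ B z)
    (hmass : ∀ V, PlaqSmall (θBal F.L γ b₀ p₀ j) V →
      0 < ∫⁻ z in {z | PlaqSmall (cW * θBal F.L γ b₀ p₀ (j + 1)) (Φ (V, z))}, (J (V, z) : ℝ≥0∞) ∂τ) :
    ∃ lam : GaugeField (F.P j) 0 ↥(Matrix.specialUnitaryGroup (Fin 2) ℂ) →
        Measure (GaugeField (F.P (j + 1)) 0 ↥(Matrix.specialUnitaryGroup (Fin 2) ℂ)),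
      (∀ V, IsFiniteMeasure (lam V)) ∧
      (∀ f : GaugeField (F.P (j + 1)) 0 ↥(Matrix.specialUnitaryGroup (Fin 2) ℂ) → ℝ, Continuous f →
        (∀ U, f U ≠ 0 → PlaqSmall (cW * θBal F.L γ b₀ p₀ (j + 1)) U) →
        ContinuousOn (fun V => ∫ U, f U ∂(lam V)) {V | PlaqSmall (θBal F.L γ b₀ p₀ j) V}) ∧
      (∀ V, PlaqSmall (θBal F.L γ b₀ p₀ j) V → 0 < lam V {U | PlaqSmall (cW * θBal F.L γ b₀ p₀ (j + 1)) U}) ∧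
      (∃ c : GaugeField (F.P j) 0 ↥(Matrix.specialUnitaryGroup (Fin 2) ℂ) → ℝ,
        ∀ f : GaugeField (F.P (j + 1)) 0 ↥(Matrix.specialUnitaryGroup (Fin 2) ℂ) → ℝ, Continuous f →
          (∀ U, ¬ PlaqSmall (cW * θBal F.L γ b₀ p₀ (j + 1)) U → f U = 0) →
          ∀ᵐ V ∂(Measure.map (descend F ℰp j) (fieldMeasure (F.P (j + 1)) 0 ↥(Matrix.specialUnitaryGroup (Fin 2) ℂ))),
            PlaqSmall (θBal F.L γ b₀ p₀ j) V → 0 < c V ∧ ∫ U, f U ∂(σ₀ V) = c V * ∫ U, f U ∂(lam V)) := by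
  classical
  haveI := hσ₀M
  haveI : BorelSpace (GaugeField (F.P (j + 1)) 0 ↥(Matrix.specialUnitaryGroup (Fin 2) ℂ)) :=
    T3OrbitAverage.instBorelSpaceGaugeField
  haveI : BorelSpace (GaugeField (F.P j) 0 ↥(Matrix.specialUnitaryGroup (Fin 2) ℂ)) :=
    T3OrbitAverage.instBorelSpaceGaugeField
  -- abbreviations
  set θ' : ℝ := θBal F.L γ b₀ p₀ (j + 1) with hθ'
  set θj : ℝ := θBal F.L γ b₀ p₀ j with hθj
  set Hf : Measure (GaugeField (F.P (j + 1)) 0 ↥(Matrix.specialUnitaryGroup (Fin 2) ℂ)) :=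
    fieldMeasure (F.P (j + 1)) 0 ↥(Matrix.specialUnitaryGroup (Fin 2) ℂ) with hHf
  set Hc : Measure (GaugeField (F.P j) 0 ↥(Matrix.specialUnitaryGroup (Fin 2) ℂ)) :=
    fieldMeasure (F.P j) 0 ↥(Matrix.specialUnitaryGroup (Fin 2) ℂ) with hHc
  haveI : IsProbabilityMeasure Hf := Missing.isProbabilityMeasure_fieldMeasure _ _
  haveI : IsProbabilityMeasure Hc := Missing.isProbabilityMeasure_fieldMeasure _ _
  have hd : Measurable (descend F ℰp j :
      GaugeField (F.P (j + 1)) 0 ↥(Matrix.specialUnitaryGroup (Fin 2) ℂ) →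
        GaugeField (F.P j) 0 ↥(Matrix.specialUnitaryGroup (Fin 2) ℂ)) :=
    T3NestedUnitLaws.measurable_descend F ℰp measurableE_ℰp j
  set ν : Measure (GaugeField (F.P j) 0 ↥(Matrix.specialUnitaryGroup (Fin 2) ℂ)) := Hf.map (descend F ℰp j) with hν
  haveI : IsProbabilityMeasure ν := Measure.isProbabilityMeasure_map hd.aemeasurable
  set W : Set (GaugeField (F.P j) 0 ↥(Matrix.specialUnitaryGroup (Fin 2) ℂ)) := {V | PlaqSmall θj V} with hW
  set O₃ : Set (GaugeField (F.P (j + 1)) 0 ↥(Matrix.specialUnitaryGroup (Fin 2) ℂ)) := {U | PlaqSmall (cW * θ') U} with hO₃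
  -- the windows are open (finitely many strict inequalities of continuous functions)
  have hopen : ∀ (Q : Params) (n : ℕ) (δ : ℝ), IsOpen {U : GaugeField Q n ↥(Matrix.specialUnitaryGroup (Fin 2) ℂ) | PlaqSmall δ U} := by
    intro Q n δ
    have e : {U : GaugeField Q n ↥(Matrix.specialUnitaryGroup (Fin 2) ℂ) | PlaqSmall δ U} =
        ⋂ p : Plaq Q n, {U | dist1 (GaugeField.plaqHol U p) < δ} := by
      ext U; simp only [PlaqSmall, Set.mem_setOf_eq, Set.mem_iInter]
    rw [e]
    exact isOpen_iInter_of_finite fun p => isOpen_lt (continuous_dist1_plaqHol p) continuous_const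
  have hWopen : IsOpen W := hopen (F.P j) 0 θj
  have hWm : MeasurableSet W := hWopen.measurableSet
  haveI : BorelSpace (GaugeField (F.P (j + 1)) 0 ↥(Matrix.specialUnitaryGroup (Fin 2) ℂ)) :=
    T3OrbitAverage.instBorelSpaceGaugeField
  have hO₃m : MeasurableSet O₃ := (hopen (F.P (j + 1)) 0 (cW * θ')).measurableSet
  -- the slices of the chart
  have hΦV : ∀ V, Measurable fun z => Φ (V, z) := fun V => hΦ.comp measurable_prodMk_left
  have hJV : ∀ V, Measurable fun z => J (V, z) := fun V => hJ.comp measurable_prodMk_left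
  -- the fibre package
  let lam : GaugeField (F.P j) 0 ↥(Matrix.specialUnitaryGroup (Fin 2) ℂ) →
      Measure (GaugeField (F.P (j + 1)) 0 ↥(Matrix.specialUnitaryGroup (Fin 2) ℂ)) :=
    fun V => if V ∈ W then ((τ.withDensity fun z => (J (V, z) : ℝ≥0∞)).map fun z => Φ (V, z)) else 0
  have hlamW : ∀ V, V ∈ W → lam V = (τ.withDensity fun z => (J (V, z) : ℝ≥0∞)).map fun z => Φ (V, z) :=
    fun V hV => if_pos hV
  -- total mass on the window is finite
  have hJlin : ∀ V, V ∈ W → ∫⁻ z, (J (V, z) : ℝ≥0∞) ∂τ < ⊤ := by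
    intro V hV
    have h1 : ∫⁻ z, (J (V, z) : ℝ≥0∞) ∂τ ≤ ∫⁻ z, ENNReal.ofReal (B z) ∂τ := by
      refine lintegral_mono_ae ?_
      filter_upwards [hJB V hV] with z hz
      rw [← ENNReal.ofReal_coe_nnreal]
      exact ENNReal.ofReal_le_ofReal hz
    exact lt_of_le_of_lt h1 hB.lintegral_lt_top
  have hfin : ∀ V, IsFiniteMeasure (lam V) := by
    intro V
    by_cases hV : V ∈ W
    · rw [hlamW V hV]
      haveI : IsFiniteMeasure (τ.withDensity fun z => (J (V, z) : ℝ≥0∞)) :=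
        isFiniteMeasure_withDensity (hJlin V hV).ne
      exact Measure.isFiniteMeasure_map _ _
    · simp only [lam, hV, if_false]
      infer_instance
  -- integrals against the fibre package = chart integrals
  have hlamint : ∀ V, V ∈ W → ∀ f : GaugeField (F.P (j + 1)) 0 ↥(Matrix.specialUnitaryGroup (Fin 2) ℂ) → ℝ,
      Continuous f → ∫ U, f U ∂(lam V) = ∫ z, (J (V, z) : ℝ) * f (Φ (V, z)) ∂τ := by
    intro V hV f hf
    rw [hlamW V hV, integral_map (hΦV V).aemeasurable hf.aestronglyMeasurable,
      integral_withDensity_eq_integral_smul (hJV V)]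
    rfl
  -- a sup bound for a continuous function on the compact fine space
  have hbdd : ∀ f : GaugeField (F.P (j + 1)) 0 ↥(Matrix.specialUnitaryGroup (Fin 2) ℂ) → ℝ, Continuous f →
      ∃ C : ℝ, 0 ≤ C ∧ ∀ U, ‖f U‖ ≤ C := by
    intro f hf
    obtain ⟨C, hC⟩ := isCompact_univ.exists_bound_of_continuousOn hf.continuousOn
    exact ⟨max C 0, le_max_right _ _, fun U => (hC U (mem_univ U)).trans (le_max_left _ _)⟩
  refine ⟨lam, hfin, ?_, ?_, ?_⟩
  · -- (A1) continuity of the fibre integrals on the window (dominated convergence)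
    intro f hf hsupp
    obtain ⟨C, hC0, hC⟩ := hbdd f hf
    have hfm : Measurable f := hf.measurable
    have hcont : ContinuousOn (fun V => ∫ z, (J (V, z) : ℝ) * f (Φ (V, z)) ∂τ) W := by
      refine Node00.continuousOn_fibreIntegral_of_dominated (U := W) (Φ := Φ) (J := J) (ρ := f) ?_ (fun z => B z * C)
        (hB.mul_const C) ?_ (hint f hf hsupp)
      · intro V _
        exact ((hJV V).coe_nnreal_real.mul (hfm.comp (hΦV V))).aestronglyMeasurable
      · intro V hV
        filter_upwards [hJB V hV] with z hz
        rw [norm_mul, Real.norm_eq_abs, abs_of_nonneg (J (V, z)).coe_nonneg]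
        exact mul_le_mul hz (hC _) (norm_nonneg _) ((J (V, z)).coe_nonneg.trans hz)
    exact hcont.congr fun V hV => hlamint V hV f hf
  · -- (A2) positive mass of the cW-window
    intro V hV
    rw [hlamW V hV, Measure.map_apply (hΦV V) hO₃m, withDensity_apply _ ((hΦV V) hO₃m)]
    exact hmass V hV
  · -- (A3) proportionality to the disintegration, with the weight `(dν/dU_j)⁻¹`
    have hac : ν ≪ Hc := absolutelyContinuous_map_descend F j
    have hνeq : Hc.withDensity (ν.rnDeriv Hc) = ν := Measure.withDensity_rnDeriv_eq ν Hc hac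
    have hpos : ∀ᵐ V ∂ν, 0 < ν.rnDeriv Hc V := Measure.rnDeriv_pos hac
    have hltc : ∀ᵐ V ∂Hc, ν.rnDeriv Hc V < ⊤ := Measure.rnDeriv_lt_top ν Hc
    have hlt : ∀ᵐ V ∂ν, ν.rnDeriv Hc V < ⊤ := hac.ae_le hltc
    have hcp : ν ⊗ₘ σ₀ = Hf.map (fun U => (descend F ℰp j U, U)) :=
      compProd_eq_map_graph_of_bind Hf hd σ₀ hbind₀ hfib₀
    refine ⟨fun V => ((ν.rnDeriv Hc V).toReal)⁻¹, fun f hf hf0 => ?_⟩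
    obtain ⟨C, hC0, hC⟩ := hbdd f hf
    have hfm : Measurable f := hf.measurable
    have hfi : Integrable f Hf := integrable_of_continuous_compact hf Hf
    have hS' : ∀ x, f x ≠ 0 → x ∈ S := fun x hx => hS x (by by_contra h; exact hx (hf0 x h))
    -- the fibre mean `I V := ∫ f dσ₀_V`: strongly measurable and bounded
    set I : GaugeField (F.P j) 0 ↥(Matrix.specialUnitaryGroup (Fin 2) ℂ) → ℝ := fun V => ∫ U, f U ∂(σ₀ V) with hI
    have hIm : StronglyMeasurable I := hf.stronglyMeasurable.integral_kernel
    have hIbd : ∀ V, ‖I V‖ ≤ C := by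
      intro V
      have h1 := norm_integral_le_of_norm_le_const (μ := σ₀ V) (f := f) (Eventually.of_forall fun U => hC U)
      simpa using h1
    -- integrability on the window of both candidates
    have hρ₁ : Integrable (fun V => (ν.rnDeriv Hc V).toReal * I V) Hc := by
      have h1 : Integrable (fun V => I V * (ν.rnDeriv Hc V).toReal) Hc :=
        (Measure.integrable_toReal_rnDeriv).bdd_mul hIm.aestronglyMeasurable (Eventually.of_forall hIbd)
      exact h1.congr (Eventually.of_forall fun V => mul_comm _ _)
    have hρ₂ : IntegrableOn (fun V => ∫ z, (J (V, z) : ℝ) * f (Φ (V, z)) ∂τ) W Hc :=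
      Node00.integrableOn_fibreIntegral_of_fibredChart (U := W) hΦ hJ hmap hfi
    -- the test identity
    have key : ∀ g : GaugeField (F.P j) 0 ↥(Matrix.specialUnitaryGroup (Fin 2) ℂ) → ℝ, Measurable g →
        (∃ Cg : ℝ, ∀ V, |g V| ≤ Cg) → (∀ V, V ∉ W → g V = 0) →
        ∫ V, ((ν.rnDeriv Hc V).toReal * I V) * g V ∂Hc = ∫ V, (∫ z, (J (V, z) : ℝ) * f (Φ (V, z)) ∂τ) * g V ∂Hc := by
      intro g hg hCg hg0
      obtain ⟨Cg, hCg'⟩ := hCg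
      have h1 := Node00.integral_mul_comp_eq_integral_fibreIntegral_mul (ν := Hf) (μ := Hc) (τ := τ) (U := W) (S := S)
        (Φ := Φ) (J := J) hWm hd hΦ hJ havgΦ hmap hfi hS' hg ⟨Cg, hCg'⟩ hg0
      rw [← h1]
      -- LHS through the density, the compProd form and the graph map
      have h2 : ∫ V, ((ν.rnDeriv Hc V).toReal * I V) * g V ∂Hc = ∫ V, I V * g V ∂ν := by
        conv_rhs => rw [← hνeq]
        rw [integral_withDensity_eq_integral_toReal_smul (Measure.measurable_rnDeriv _ _) hltc]
        refine integral_congr_ae (Eventually.of_forall fun V => ?_)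
        simp only [smul_eq_mul]
        ring
      have hint : Integrable (fun p : GaugeField (F.P j) 0 ↥(Matrix.specialUnitaryGroup (Fin 2) ℂ) ×
          GaugeField (F.P (j + 1)) 0 ↥(Matrix.specialUnitaryGroup (Fin 2) ℂ) => f p.2 * g p.1) (ν ⊗ₘ σ₀) := by
        refine Integrable.mono' (integrable_const (C * Cg))
          ((hfm.comp measurable_snd).mul (hg.comp measurable_fst)).aestronglyMeasurable
          (Eventually.of_forall fun p => ?_)
        rw [norm_mul]
        exact mul_le_mul (hC _) (by simpa [Real.norm_eq_abs] using hCg' p.1) (norm_nonneg _) hC0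
      have h3 : ∫ V, I V * g V ∂ν = ∫ p, f p.2 * g p.1 ∂(ν ⊗ₘ σ₀) := by
        rw [Measure.integral_compProd hint]
        refine integral_congr_ae (Eventually.of_forall fun V => ?_)
        simp only [hI]
        rw [← integral_mul_const]
      have h4 : ∫ p, f p.2 * g p.1 ∂(ν ⊗ₘ σ₀) = ∫ U, f U * g (descend F ℰp j U) ∂Hf := by
        rw [hcp]
        exact integral_map (hd.prodMk measurable_id').aemeasurable
          ((hfm.comp measurable_snd).mul (hg.comp measurable_fst)).aestronglyMeasurable
      rw [h2, h3, h4]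
    have hae := Node00.ae_eq_restrict_of_forall_integral_mul_eq hWm hρ₁.integrableOn hρ₂ key
    have hae' : ∀ᵐ V ∂Hc, V ∈ W → (ν.rnDeriv Hc V).toReal * I V = ∫ z, (J (V, z) : ℝ) * f (Φ (V, z)) ∂τ :=
      (ae_restrict_iff' hWm).1 hae
    filter_upwards [hac.ae_le hae', hpos, hlt] with V hVeq hVpos hVlt
    intro hVW
    have hr : 0 < (ν.rnDeriv Hc V).toReal := ENNReal.toReal_pos hVpos.ne' hVlt.ne
    refine ⟨inv_pos.mpr hr, ?_⟩
    rw [hlamint V hVW f hf, ← hVeq hVW, ← mul_assoc, inv_mul_cancel₀ hr.ne', one_mul]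

end Summit.QuantumFields.YangMills.Theorems.OrganTangentFibredChartBridgeIntegrandAnyCut

end
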